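import Summits.QuantumFields.BalabanUV.Beta.D1BFx.NeedleGhostBubble2Pointwise
import Summits.QuantumFields.BalabanUV.Beta.D1BFx.NeedleGhostBubbleRow
import Summits.QuantumFields.BalabanUV.Beta.D1BFx.NeedleGhostTadpoleRowSharp
import Summits.QuantumFields.BalabanUV.Beta.D1BFx.BlockColumnSupNorm

/-!
# `BalabanUV.Beta.D1BFx.NeedleGhostBubble2Row` — road «BF-x» for binder row D1, slot (K), END row `hGrp gN` (NEEDLES ∪ G_R), (N-2) row «NT-6»:
# THE GHOST BUBBLE ROW `h₆` (`qA ⊗ qA` over `Ggh`) OF `NeedleRowGlue.abs_gN_row_le_of_tables` MODULO ONE UNITS LINE `|ωgh n·cQ n·cQ n| ≤ k·n⁴` —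
# TOLERANCE `n⁴` (owner FINDING U-1's route: four placements with the SIGNED block sums `gq` and the sup of the leg, the RUNNING and the BASE
# bond each summed FIRST by the bond marginal M7), constant `C₆ := k·(cG² + cG·S)·(1 + 4∕δ_u)²·K₄(δ_u∕2)` explicit and n-FREE

HONEST DEPENDENCY (cell records, verbatim): «continuum YM on T⁴ ⇐ BetaPertH ∧ nine spine estimates (0/9 proved); BetaPertH ⇐ (D1) ∧ (D4) ∧
CAP+tail; G-an2-4 gates asym, D1 and NE2/3/4.»  HONEST FRAMING (cell contract, verbatim): «discharging `BetaPertH` makes Bałaban's UV stability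
UNCONDITIONAL — a real constructive-QFT result; it is NOT the continuum limit and NOT the Clay problem.»  THIS MODULE DISCHARGES NOTHING of the wall:
it is [folklore] lattice bookkeeping BY NAME over the OWNER's pointwise half `NeedleGhostBubble2Pointwise.abs_biBubble_qAntiAt_qAntiAt_le` (p258530; the
four-placement bound with abstract leg letters), the tree's leg letters `BlockColumnSupNorm.abs_gq_le_sup` (signed block sums, `cG 4 a`, rate `δ_u`, n-FREE)
and `GhostLeg.bdd_Ggh` (sup `2∕min 2 a`), the bond marginal M7 `NeedleBondMarginal.sum_B_sum_bond_abs_qJetAt_le` (running bond, per block) and leaf-04-g8's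
`NeedleGhostTadpoleRowSharp.blk_resSite` ∕ `sum_resSite_abs_qJetAt_le` (base bond), my lattice lemmas `NeedleGhostBubbleRow.abs_weight_le` ∕ `sq_mul_exp_le`,
`B6QGQLower276.subset_U_image` ∕ `sum_U`, `B4Sect5Proof.latticeSum_le`, `WindowIdentification.fullSum_eq_tsum_sub`.  No `def`, no `def … : Prop`, nothing
cited, 0 sorry.  THE ONLY DISPLAYED LETTER is the scalar UNITS inequality `|ωgh n·(cQ n·cQ n)| ≤ k·n⁴` (slot (K)'s pinning — ruled nowhere here; at the
owner's ray of record `ωgh·cQ² = −4N²a²·n⁴`, U-1, it holds with `k = 4N²a²`; under branch (ii) of my located finding F-gan24leaf05-g41-1 the raw-`Ggh` words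
gain n⁴ and the line is NOT met by this bound — the file is agnostic).  Asserts nothing of Bałaban's.  Root-level binders hW ∕ hR-sockets ∕ hSX-socket ∕
D1Tel ∕ D1Rep — 0 discharged; (K) NOT closed; NOT D1, NOT `BetaPertH`, NOT continuum, NOT Clay.

ABSOLUTE RULE (cell charter, verbatim): «No internally-minted statement may enter as a cited fact. Every hypothesis is either kernel-proved in this
package or a verbatim quotation of a PUBLISHED theorem with page reference. The manuscript(s) under audit are NOT citable for their own disputed
steps — they are the thing under adjudication; programme-internal (2001/route/tribunal) claims are never citable.»

WHY (owner d1-p2-g9 STATEMENT LINE «NT-6» 08:47Z: «`h₆_of_sharpCount (ha) (hk : ∀ n ≥ 2, |ωgh n * (cQ n * cQ n)| ≤ k * (n:ℝ)^4) (μ ν) : [h₆]` with `C₆ := k·K₆(a)`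
EXPLICIT and n-FREE; ROUTE (U-1): … the legs enter ONLY as (i) SUP … (ii) signed block sums `gq ≤ cG` … use the bond marginal to sum over the bond FIRST»;
«T₆ next (leaf-05 first refusal)» l.29594; «the NT-6 ROW stays gan24-leaf-05-g41's first refusal» l.29693; an3-g57 [AN3-G57-N36] (2): T₆ = n⁰ with the MIXED
placement dominant, no cancellation).  `T₆(u, u′) = −½·biBubble (Ggh) (qA_u) (Ggh) (qA_{u′})`; the owner's bound with `RA = RK = CA = CK = cG·e^{−δ_u·dist(blk u, blk u′)}`
(`abs_gq_le_sup`, rows AND columns by `Ggh_symm`) and `SA = SK = 2∕min 2 a` gives `|T₆(u,u′)| ≤ (cG² + n⁴·cG·S)·e^{−δ_u·dist}·G₁(u)·G₁′(u′)`, `G₁` the block `ℓ¹`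
of the jet; the (1.22) weight costs `(n·(dist + 1))²`; summing the RUNNING bond `u = b + w` over a block costs `Σ_{u∈B} G₁(u) ≤ n⁴·((n−1)·n⁻⁴)` (M7), the block
sum an n-free lattice constant, and the BASE bond average `n⁻⁴·Σ_b G₁′(b) ≤ (n−1)·n⁻⁴` (M7 on the residue sites): net `n⁻⁸·n⁴·n²·n·n·n⁻⁴ = n⁻⁴` against the
weight's `n⁴` — TOLERANCE n⁴, exactly U-1's.

CONTENT (all [folklore]; `B = B6QGQLower276.B (n − 1)`, `blk = blk (n − 1)`; block side `n` (`[NeZero n]`), `0 < a`).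
* §1 lattice bookkeeping with a MASS: **`sum_le_of_blockDecay_mass`** (`0 ≤ h ≤ c·e^{−δ·dist(β₀, blk u)}·F u`, `Σ_{u ∈ B β′} F u ≤ m` ⟹ `Σ_{u∈S} h u ≤ c·m·K₄(δ)`),
  **`tsum_weight_le_of_blockDecay_mass`** (the (1.22)-weighted `w`-sum: `≤ M·(n²·((1+4∕δ)²·(m·K₄(δ∕2))))` + summability), `abs_fullSum_weight_le_of_blockDecay_mass`.
* §2 at the ghost leg: `sum_B_Ggh_eq_gq` ∕ `sum_B_Ggh_col_eq_gq` (`rfl` ∕ `Ggh_symm`), **`abs_T₆_le`** (`≤ (cG² + n⁴·cG·S)·e^{−δ_u·dist(blk u, blk u′)}·G₁(u)·G₁′(u′)`),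
  `sum_B_jetMass_le` (running bond per block, M7), `sum_resSite_jetMass_le` (base bond, M7), **`abs_row₆_le`** (fixed `n`: `|c·Σ_b n⁻⁴·(n⁻⁸·fullSum …)| ≤ |c|·n⁻⁴·K₆′`).
* §3 in the glue's currency: **`h₆_of_scaling (ha) (hk : ∀ n ≥ 2, |ωgh n * (cQ n * cQ n)| ≤ k * n^4) (μ ν) ⊢ h₆` VERBATIM**, `C₆ := k·((cG 4 a)² + cG 4 a·(2∕min 2 a))·((1 + 4∕deltaU 4 a)²·latticeConst 4 (deltaU 4 a∕2))`.
Unit `b2b-balaban-gan24-formalise-leaf-05` (gen 41), G-an2-4 swarm leaf prover on cross-lane kernel duty; `LEAVES-BFx.md` row (N) ∕ (N-2) «NT-6 ROW».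
-/

noncomputable section

namespace Summit.QuantumFields.BalabanUV.Beta.D1BFx.NeedleGhostBubble2Row

open Finset
open scoped BigOperators
open Literature.MathematicalPhysics.QuantumFieldTheory.Balaban1983to89
open Literature.MathematicalPhysics.QuantumFieldTheory.Balaban1983to89.Beta
open B4Sect5Proof (latticeConst latticeConst_nonneg latticeSum_le)
open B6QGQLower276 (X blk B mem_B U sum_U subset_U_image)
open B6QGQDecay237 (deltaU deltaU_pos)
open B5Hk103ScalarZd (gq)
open ExpKernelCalculus (Site MKer)
open DyadicShell (Pt toReal toReal_apply)
open WindowIdentification (fullSum fullSum_eq_tsum_sub)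
open DressedMomentNormalisation (resSite)
open KernelWard (Bdd)
open Summit.QuantumFields.BalabanUV.Beta.D1BFx.PackedKernelSplit (biBubble)
open Summit.QuantumFields.BalabanUV.Beta.D1BFx.FineHessianSectors (biBubbleTable biBubbleTable_apply)
open Summit.QuantumFields.BalabanUV.Beta.D1BFx.GhostStencilRooted (qJetAt qAntiAt)
open Summit.QuantumFields.BalabanUV.Beta.D1BFx.GhostStencilRootedReflection (ctrHalf ctrHalf_mem)
open Summit.QuantumFields.BalabanUV.Beta.D1BFx.GhostLeg (Ggh Ggh_apply Ggh_symm bdd_Ggh const_nonneg cast_pred_add_one)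
open Summit.QuantumFields.BalabanUV.Beta.D1BFx.BlockColumnSupNorm (cG cG_pos abs_gq_le_sup)
open Summit.QuantumFields.BalabanUV.Beta.D1BFx.GhostNeedleRootedLetters (sum_B_const')
open Summit.QuantumFields.BalabanUV.Beta.D1BFx.NeedleBondMarginal (sum_B_sum_bond_abs_qJetAt_le)
open Summit.QuantumFields.BalabanUV.Beta.D1BFx.NeedleGhostBubbleRow (abs_weight_le sq_mul_exp_le)
open Summit.QuantumFields.BalabanUV.Beta.D1BFx.NeedleGhostBubble2Pointwise (abs_biBubble_qAntiAt_qAntiAt_le)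
open Summit.QuantumFields.BalabanUV.Beta.D1BFx.NeedleGhostTadpoleRowSharp (blk_resSite sum_resSite_abs_qJetAt_le)

variable (n : ℕ) [NeZero n]

/-! ## §1 Lattice bookkeeping with a mass -/

omit [NeZero n] in
/-- [folklore] **BLOCK DECAY × A MASS WITH BOUNDED BLOCK SUMS ⟹ UNIFORMLY BOUNDED FINITE SUMS**: `0 ≤ h u ≤ c·e^{−δ·dist(β₀, blk u)}·F u` with `F ≥ 0`,
`Σ_{u ∈ B β′} F u ≤ m` for every block `β′` ⟹ `Σ_{u ∈ S} h u ≤ c·m·K₄(δ)` for every finite `S`. -/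
theorem sum_le_of_blockDecay_mass {h F : Site 4 → ℝ} (hh0 : ∀ u, 0 ≤ h u) (hF0 : ∀ u, 0 ≤ F u) {c δ m : ℝ} (hc : 0 ≤ c) (hδ : 0 < δ) (β₀ : Site 4)
    (hh : ∀ u, h u ≤ c * Real.exp (-(δ * dist β₀ (blk (n - 1) u))) * F u) (hm : ∀ β' : Site 4, ∑ u ∈ B (n - 1) β', F u ≤ m)
    (S : Finset (Site 4)) : ∑ u ∈ S, h u ≤ c * m * latticeConst 4 δ := by
  classical
  have hm0 : 0 ≤ m := (Finset.sum_nonneg fun u _ => hF0 u).trans (hm 0)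
  calc ∑ u ∈ S, h u ≤ ∑ u ∈ U (n - 1) (S.image (blk (n - 1))), h u :=
        Finset.sum_le_sum_of_subset_of_nonneg (subset_U_image (n - 1) S) fun u _ _ => hh0 u
    _ = ∑ y ∈ S.image (blk (n - 1)), ∑ u ∈ B (n - 1) y, h u := sum_U _ _
    _ ≤ ∑ y ∈ S.image (blk (n - 1)), ∑ u ∈ B (n - 1) y, c * Real.exp (-(δ * dist β₀ y)) * F u := by
        refine Finset.sum_le_sum fun y _ => Finset.sum_le_sum fun u hu => ?_
        have h1 := hh u
        rwa [mem_B.1 hu] at h1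
    _ = ∑ y ∈ S.image (blk (n - 1)), c * Real.exp (-(δ * dist β₀ y)) * ∑ u ∈ B (n - 1) y, F u := by
        refine Finset.sum_congr rfl fun y _ => ?_
        rw [Finset.mul_sum]
    _ ≤ ∑ y ∈ S.image (blk (n - 1)), c * Real.exp (-(δ * dist β₀ y)) * m :=
        Finset.sum_le_sum fun y _ => mul_le_mul_of_nonneg_left (hm y) (by positivity)
    _ = c * m * ∑ y ∈ S.image (blk (n - 1)), Real.exp (-(δ * dist β₀ y)) := by rw [Finset.mul_sum]; exact Finset.sum_congr rfl fun y _ => by ring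
    _ ≤ c * m * latticeConst 4 δ := mul_le_mul_of_nonneg_left (latticeSum_le 4 hδ _ β₀) (mul_nonneg hc hm0)

/-- [folklore] **THE WEIGHTED `w`-SUM AGAINST BLOCK DECAY × A MASS**: if `|f w| ≤ M·e^{−δ·dist(blk (b+w), blk b)}·F (b+w)` (`M ≥ 0`, `δ > 0`, `F ≥ 0` with block
sums `≤ m`) then `w ↦ |w_μ·w_ν·f w|` is summable and `Σ'_w |w_μ·w_ν·f w| ≤ M·(n²·((1 + 4∕δ)²·(m·K₄(δ∕2))))`. -/
theorem tsum_weight_le_of_blockDecay_mass {f : Pt → ℝ} {F : Site 4 → ℝ} {M δ m : ℝ} (hM : 0 ≤ M) (hδ : 0 < δ) (hF0 : ∀ u, 0 ≤ F u)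
    (hm : ∀ β' : Site 4, ∑ u ∈ B (n - 1) β', F u ≤ m) (b : Pt) (μ ν : Fin 4)
    (hf : ∀ w : Pt, |f w| ≤ M * Real.exp (-(δ * dist (blk (n - 1) (b + w)) (blk (n - 1) b))) * F (b + w)) :
    Summable (fun w : Pt => |toReal w μ * toReal w ν * f w|) ∧
      ∑' w : Pt, |toReal w μ * toReal w ν * f w| ≤ M * ((n : ℝ) ^ 2 * ((1 + 4 / δ) ^ 2 * (m * latticeConst 4 (δ / 2)))) := by
  have hn : (0 : ℝ) < n := Nat.cast_pos.mpr (Nat.pos_of_ne_zero (NeZero.ne n))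
  set c : ℝ := M * ((n : ℝ) ^ 2 * (1 + 4 / δ) ^ 2) with hc
  have hc0 : 0 ≤ c := by positivity
  have hdom : ∀ w : Pt, |toReal w μ * toReal w ν * f w| ≤ c * Real.exp (-(δ / 2 * dist (blk (n - 1) b) (blk (n - 1) (b + w)))) * F (b + w) := by
    intro w
    set k : ℝ := dist (blk (n - 1) (b + w)) (blk (n - 1) b) with hk
    have hk0 : 0 ≤ k := dist_nonneg
    have h1 := abs_weight_le n b w μ ν
    have h2 := hf w
    have h3 := sq_mul_exp_le hδ hk0
    have hFw := hF0 (b + w)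
    rw [abs_mul]
    calc |toReal w μ * toReal w ν| * |f w| ≤ ((n : ℝ) * (k + 1)) ^ 2 * (M * Real.exp (-(δ * k)) * F (b + w)) :=
          mul_le_mul h1 h2 (abs_nonneg _) (by positivity)
      _ = M * (n : ℝ) ^ 2 * ((k + 1) ^ 2 * Real.exp (-(δ * k))) * F (b + w) := by ring
      _ ≤ M * (n : ℝ) ^ 2 * ((1 + 4 / δ) ^ 2 * Real.exp (-(δ / 2 * k))) * F (b + w) :=
          mul_le_mul_of_nonneg_right (mul_le_mul_of_nonneg_left h3 (by positivity)) hFw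
      _ = c * Real.exp (-(δ / 2 * dist (blk (n - 1) b) (blk (n - 1) (b + w)))) * F (b + w) := by rw [hc, hk, dist_comm]; ring
  have hfin : ∀ S : Finset Pt, ∑ w ∈ S, |toReal w μ * toReal w ν * f w| ≤ M * ((n : ℝ) ^ 2 * ((1 + 4 / δ) ^ 2 * (m * latticeConst 4 (δ / 2)))) := by
    intro S
    have h1 : ∑ w ∈ S, |toReal w μ * toReal w ν * f w|
        ≤ ∑ w ∈ S, c * Real.exp (-(δ / 2 * dist (blk (n - 1) b) (blk (n - 1) (b + w)))) * F (b + w) := Finset.sum_le_sum fun w _ => hdom w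
    have h2 : ∑ w ∈ S, c * Real.exp (-(δ / 2 * dist (blk (n - 1) b) (blk (n - 1) (b + w)))) * F (b + w)
        = ∑ p ∈ S.map (addLeftEmbedding b), c * Real.exp (-(δ / 2 * dist (blk (n - 1) b) (blk (n - 1) p))) * F p := by
      rw [Finset.sum_map]
      rfl
    have h3 := sum_le_of_blockDecay_mass n (h := fun p => c * Real.exp (-(δ / 2 * dist (blk (n - 1) b) (blk (n - 1) p))) * F p)
      (fun p => by have := hF0 p; positivity) hF0 hc0 (half_pos hδ) (blk (n - 1) b) (fun p => le_rfl) hm (S.map (addLeftEmbedding b))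
    calc ∑ w ∈ S, |toReal w μ * toReal w ν * f w| ≤ c * m * latticeConst 4 (δ / 2) := by rw [h2] at h1; exact h1.trans h3
      _ = M * ((n : ℝ) ^ 2 * ((1 + 4 / δ) ^ 2 * (m * latticeConst 4 (δ / 2)))) := by rw [hc]; ring
  have hsum : Summable (fun w : Pt => |toReal w μ * toReal w ν * f w|) := summable_of_sum_le (fun w => abs_nonneg _) hfin
  exact ⟨hsum, hsum.tsum_le_of_sum_le hfin⟩

/-- [folklore] **THE JUNCTION**: under the same domination, `|fullSum (w ↦ w_μ w_ν f w)| ≤ M·(n²·((1 + 4∕δ)²·(m·K₄(δ∕2))))`. -/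
theorem abs_fullSum_weight_le_of_blockDecay_mass {f : Pt → ℝ} {F : Site 4 → ℝ} {M δ m : ℝ} (hM : 0 ≤ M) (hδ : 0 < δ) (hF0 : ∀ u, 0 ≤ F u)
    (hm : ∀ β' : Site 4, ∑ u ∈ B (n - 1) β', F u ≤ m) (b : Pt) (μ ν : Fin 4)
    (hf : ∀ w : Pt, |f w| ≤ M * Real.exp (-(δ * dist (blk (n - 1) (b + w)) (blk (n - 1) b))) * F (b + w)) :
    |fullSum (fun w : Pt => toReal w μ * toReal w ν * f w)| ≤ M * ((n : ℝ) ^ 2 * ((1 + 4 / δ) ^ 2 * (m * latticeConst 4 (δ / 2)))) := by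
  obtain ⟨hs, hle⟩ := tsum_weight_le_of_blockDecay_mass n hM hδ hF0 hm b μ ν hf
  have hs' : Summable (fun w : Pt => toReal w μ * toReal w ν * f w) := hs.of_abs
  rw [fullSum_eq_tsum_sub _ hs']
  have h0 : toReal (0 : Pt) μ * toReal (0 : Pt) ν * f 0 = 0 := by simp [toReal_apply]
  rw [h0, sub_zero]
  have h1 : ‖∑' w : Pt, toReal w μ * toReal w ν * f w‖ ≤ ∑' w : Pt, ‖toReal w μ * toReal w ν * f w‖ := norm_tsum_le_tsum_norm hs
  simpa only [Real.norm_eq_abs] using h1.trans hle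

/-! ## §2 At the ghost leg: the pointwise bound, the two bond sums, the row at fixed `n` -/

variable (a : ℝ)

/-- [folklore] The signed block ROW sums of the ghost leg ARE the `gq` kernel (definitionally). -/
theorem sum_B_Ggh_eq_gq (z w : Site 4) : ∑ t ∈ B (n - 1) w, Ggh n a z t () () = gq (n - 1) a z w := rfl

/-- [folklore] The signed block COLUMN sums of the ghost leg are the `gq` kernel too (`Ggh_symm`). -/
theorem sum_B_Ggh_col_eq_gq (ha : 0 < a) (t w : Site 4) : ∑ x ∈ B (n - 1) w, Ggh n a x t () () = gq (n - 1) a t w := by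
  rw [← sum_B_Ggh_eq_gq n a t w]
  exact Finset.sum_congr rfl fun x _ => Ggh_symm n a ha x t () ()

/-- [folklore] **THE POINTWISE BOUND OF `T₆ = qA ⊗ qA` OVER THE GHOST LEG** (owner U-1's four placements; legs by the signed block sums `gq ≤ cG·e^{−δ_u·dist}` and
the sup `2∕min 2 a`): `|T₆(u, u′)| ≤ ((cG 4 a)² + n⁴·(cG 4 a·(2∕min 2 a)))·e^{−δ_u·dist(blk u, blk u′)}·G₁(u)·G₁′(u′)`. -/
theorem abs_T₆_le (ha : 0 < a) (ρ : Site 4) (κ lam : Fin 4) (u u' : Site 4) :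
    |biBubbleTable (Ggh n a) (Ggh n a) (qAntiAt ρ n) (qAntiAt ρ n) κ lam u u'| ≤
      ((cG 4 a) ^ 2 + (n : ℝ) ^ 4 * (cG 4 a * (2 / min 2 a))) * Real.exp (-(deltaU 4 a * dist (blk (n - 1) u) (blk (n - 1) u'))) *
        ((∑ z ∈ B (n - 1) (blk (n - 1) u), |qJetAt ρ n κ u (blk (n - 1) u) z|) *
         (∑ x ∈ B (n - 1) (blk (n - 1) u'), |qJetAt ρ n lam u' (blk (n - 1) u') x|)) := by
  have hn : (0 : ℝ) < n := Nat.cast_pos.mpr (Nat.pos_of_ne_zero (NeZero.ne n))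
  have hcG := (cG_pos 4 ha).le
  have hS := const_nonneg a ha
  set Y := blk (n - 1) u with hY
  set Y' := blk (n - 1) u' with hY'
  set E : ℝ := Real.exp (-(deltaU 4 a * dist Y Y')) with hE
  have hE0 : 0 ≤ E := (Real.exp_pos _).le
  have hE1 : E ≤ 1 := Real.exp_le_one_iff.2 (by have := deltaU_pos 4 ha; nlinarith [dist_nonneg (x := Y) (y := Y')])
  -- the leg letters
  have hRA : ∀ x ∈ B (n - 1) Y', |∑ t ∈ B (n - 1) Y, Ggh n a x t () ()| ≤ cG 4 a * E := by
    intro x hx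
    rw [sum_B_Ggh_eq_gq]
    have h := abs_gq_le_sup (d := 4) (by norm_num) (n - 1) ha x Y
    rwa [mem_B.1 hx, dist_comm] at h
  have hRK : ∀ z ∈ B (n - 1) Y, |∑ t ∈ B (n - 1) Y', Ggh n a z t () ()| ≤ cG 4 a * E := by
    intro z hz
    rw [sum_B_Ggh_eq_gq]
    have h := abs_gq_le_sup (d := 4) (by norm_num) (n - 1) ha z Y'
    rwa [mem_B.1 hz] at h
  have hCA : ∀ t ∈ B (n - 1) Y, |∑ x ∈ B (n - 1) Y', Ggh n a x t () ()| ≤ cG 4 a * E := by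
    intro t ht
    rw [sum_B_Ggh_col_eq_gq n a ha]
    have h := abs_gq_le_sup (d := 4) (by norm_num) (n - 1) ha t Y'
    rwa [mem_B.1 ht] at h
  have hCK : ∀ t ∈ B (n - 1) Y', |∑ z ∈ B (n - 1) Y, Ggh n a z t () ()| ≤ cG 4 a * E := by
    intro t ht
    rw [sum_B_Ggh_col_eq_gq n a ha]
    have h := abs_gq_le_sup (d := 4) (by norm_num) (n - 1) ha t Y
    rwa [mem_B.1 ht, dist_comm] at h
  have hSup : ∀ x t : Site 4, |Ggh n a x t () ()| ≤ 2 / min 2 a := fun x t => bdd_Ggh n a ha x t () ()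
  have h := abs_biBubble_qAntiAt_qAntiAt_le ρ n κ u lam u' (Ggh n a) (Ggh n a) (by positivity) hS hRA hRK hCA hCK
    (fun x _ t _ => hSup x t) (fun z _ t _ => hSup z t)
  set G₁ := ∑ z ∈ B (n - 1) Y, |qJetAt ρ n κ u Y z| with hG₁
  set G₁' := ∑ x ∈ B (n - 1) Y', |qJetAt ρ n lam u' Y' x| with hG₁'
  have hG0 : 0 ≤ G₁ * G₁' := mul_nonneg (Finset.sum_nonneg fun _ _ => abs_nonneg _) (Finset.sum_nonneg fun _ _ => abs_nonneg _)
  rw [biBubbleTable_apply, abs_mul, show |(-(1 / 2 : ℝ))| = 1 / 2 by norm_num]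
  have hcoef : cG 4 a * E * (cG 4 a * E) + (n : ℝ) ^ 4 * (cG 4 a * E) * (2 / min 2 a) + (n : ℝ) ^ 4 * (2 / min 2 a) * (cG 4 a * E)
      + cG 4 a * E * (cG 4 a * E) ≤ 2 * (((cG 4 a) ^ 2 + (n : ℝ) ^ 4 * (cG 4 a * (2 / min 2 a))) * E) := by
    have h1 : E * E ≤ E := by nlinarith
    nlinarith [mul_nonneg (mul_nonneg hcG hcG) (sub_nonneg.2 h1), pow_nonneg hn.le 4]
  calc 1 / 2 * |biBubble (Ggh n a) (qAntiAt ρ n κ u) (Ggh n a) (qAntiAt ρ n lam u')|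
      ≤ 1 / 2 * ((cG 4 a * E * (cG 4 a * E) + (n : ℝ) ^ 4 * (cG 4 a * E) * (2 / min 2 a) + (n : ℝ) ^ 4 * (2 / min 2 a) * (cG 4 a * E)
          + cG 4 a * E * (cG 4 a * E)) * (G₁ * G₁')) := mul_le_mul_of_nonneg_left h (by norm_num)
    _ ≤ 1 / 2 * (2 * (((cG 4 a) ^ 2 + (n : ℝ) ^ 4 * (cG 4 a * (2 / min 2 a))) * E) * (G₁ * G₁')) :=
        mul_le_mul_of_nonneg_left (mul_le_mul_of_nonneg_right hcoef hG0) (by norm_num)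
    _ = ((cG 4 a) ^ 2 + (n : ℝ) ^ 4 * (cG 4 a * (2 / min 2 a))) * E * (G₁ * G₁') := by ring

/-- [folklore] **THE RUNNING BOND SUMMED OVER A BLOCK** (M7, in-block root): `Σ_{u ∈ B β′} Σ_{z ∈ B(blk u)} |qJetAt ρ n κ u (blk u) z| ≤ n⁴·((n−1)·n⁻⁴)`. -/
theorem sum_B_jetMass_le {ρ : Site 4} (hρ : ∀ i : Fin 4, 0 ≤ ρ i ∧ ρ i < n) (κ : Fin 4) (β' : Site 4) :
    ∑ u ∈ B (n - 1) β', ∑ z ∈ B (n - 1) (blk (n - 1) u), |qJetAt ρ n κ u (blk (n - 1) u) z| ≤ (n : ℝ) ^ 4 * (((n : ℝ) - 1) * ((n : ℝ) ^ 4)⁻¹) := by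
  have e : ∑ u ∈ B (n - 1) β', ∑ z ∈ B (n - 1) (blk (n - 1) u), |qJetAt ρ n κ u (blk (n - 1) u) z|
      = ∑ u ∈ B (n - 1) β', ∑ z ∈ B (n - 1) β', |qJetAt ρ n κ u β' z| :=
    Finset.sum_congr rfl fun u hu => by rw [mem_B.1 hu]
  rw [e, Finset.sum_comm]
  exact sum_B_sum_bond_abs_qJetAt_le n κ hρ (B (n - 1) β') β'

/-- [folklore] **THE BASE BOND AVERAGED OVER THE RESIDUE SITES** (M7 at root block `0`, leaf-04-g8's `sum_resSite_abs_qJetAt_le`):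
`Σ_{b ∈ image resSite} n⁻⁴·Σ_{x ∈ B(blk b)} |qJetAt (ctrHalf n) n ν b (blk b) x| ≤ (n−1)·n⁻⁴`. -/
theorem sum_resSite_jetMass_le (ν : Fin 4) :
    ∑ b ∈ (univ : Finset (Fin 4 → Fin n)).image resSite, ((n : ℝ) ^ 4)⁻¹ *
        ∑ x ∈ B (n - 1) (blk (n - 1) b), |qJetAt (ctrHalf n) n ν b (blk (n - 1) b) x| ≤ ((n : ℝ) - 1) * ((n : ℝ) ^ 4)⁻¹ := by
  have hn : (0 : ℝ) < n := Nat.cast_pos.mpr (Nat.pos_of_ne_zero (NeZero.ne n))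
  have hw : (0 : ℝ) ≤ ((n : ℝ) ^ 4)⁻¹ := inv_nonneg.mpr (pow_pos hn 4).le
  have e : ∑ b ∈ (univ : Finset (Fin 4 → Fin n)).image resSite, ((n : ℝ) ^ 4)⁻¹ *
        ∑ x ∈ B (n - 1) (blk (n - 1) b), |qJetAt (ctrHalf n) n ν b (blk (n - 1) b) x|
      = ((n : ℝ) ^ 4)⁻¹ * ∑ x ∈ B (n - 1) 0, ∑ b ∈ (univ : Finset (Fin 4 → Fin n)).image resSite, |qJetAt (ctrHalf n) n ν b 0 x| := by
    rw [Finset.sum_comm, Finset.mul_sum]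
    refine Finset.sum_congr rfl fun b hb => ?_
    obtain ⟨r, _, rfl⟩ := Finset.mem_image.1 hb
    rw [blk_resSite]
  rw [e]
  calc ((n : ℝ) ^ 4)⁻¹ * ∑ x ∈ B (n - 1) 0, ∑ b ∈ (univ : Finset (Fin 4 → Fin n)).image resSite, |qJetAt (ctrHalf n) n ν b 0 x|
      ≤ ((n : ℝ) ^ 4)⁻¹ * ∑ _x ∈ B (n - 1) (0 : Site 4), ((n : ℝ) - 1) * ((n : ℝ) ^ 4)⁻¹ :=
        mul_le_mul_of_nonneg_left (Finset.sum_le_sum fun x _ => sum_resSite_abs_qJetAt_le n ν x) hw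
    _ = ((n : ℝ) - 1) * ((n : ℝ) ^ 4)⁻¹ := by rw [sum_B_const']; field_simp

/-- [folklore] **THE ROW OF `T₆` AT FIXED `n`**, for any scalar prefactor `c`:
`|c·Σ_{b ∈ image resSite} n⁻⁴·(n⁻⁸·fullSum (w ↦ w_μw_ν·T₆(b+w,b)))| ≤ |c|·(n⁴)⁻¹·(((cG 4 a)² + cG 4 a·(2∕min 2 a))·((1 + 4∕δ_u)²·latticeConst 4 (δ_u∕2)))`. -/
theorem abs_row₆_le (ha : 0 < a) (c : ℝ) (μ ν : Fin 4) :
    |c * ∑ b ∈ (univ : Finset (Fin 4 → Fin n)).image resSite, ((n : ℝ) ^ 4)⁻¹ * (((n : ℝ) ^ 8)⁻¹ *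
        fullSum (fun w : Pt => toReal w μ * toReal w ν *
          biBubbleTable (Ggh n a) (Ggh n a) (qAntiAt (ctrHalf n) n) (qAntiAt (ctrHalf n) n) μ ν (b + w) b))|
      ≤ |c| * (((n : ℝ) ^ 4)⁻¹ * (((cG 4 a) ^ 2 + cG 4 a * (2 / min 2 a)) * ((1 + 4 / deltaU 4 a) ^ 2 * latticeConst 4 (deltaU 4 a / 2)))) := by
  have hn : (0 : ℝ) < n := Nat.cast_pos.mpr (Nat.pos_of_ne_zero (NeZero.ne n))
  have hn1 : (1 : ℝ) ≤ n := by exact_mod_cast NeZero.one_le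
  have hcG := (cG_pos 4 ha).le
  have hS := const_nonneg a ha
  have hδ := deltaU_pos 4 ha
  have hL := latticeConst_nonneg 4 (half_pos hδ).le
  set A₆ : ℝ := (cG 4 a) ^ 2 + (n : ℝ) ^ 4 * (cG 4 a * (2 / min 2 a)) with hA₆
  have hA0 : 0 ≤ A₆ := by positivity
  set KK : ℝ := (1 + 4 / deltaU 4 a) ^ 2 * (((n : ℝ) ^ 4 * (((n : ℝ) - 1) * ((n : ℝ) ^ 4)⁻¹)) * latticeConst 4 (deltaU 4 a / 2)) with hKK
  have hmid : 0 ≤ (n : ℝ) ^ 4 * (((n : ℝ) - 1) * ((n : ℝ) ^ 4)⁻¹) :=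
    mul_nonneg (by positivity) (mul_nonneg (by linarith) (by positivity))
  have hK0 : 0 ≤ KK := by rw [hKK]; exact mul_nonneg (by positivity) (mul_nonneg hmid hL)
  -- each base site: the w-sum by §1 with the running-bond mass of M7
  have hword : ∀ b : Pt, |fullSum (fun w : Pt => toReal w μ * toReal w ν *
        biBubbleTable (Ggh n a) (Ggh n a) (qAntiAt (ctrHalf n) n) (qAntiAt (ctrHalf n) n) μ ν (b + w) b)|
      ≤ (A₆ * ∑ x ∈ B (n - 1) (blk (n - 1) b), |qJetAt (ctrHalf n) n ν b (blk (n - 1) b) x|) * ((n : ℝ) ^ 2 * KK) := by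
    intro b
    have hG' : 0 ≤ ∑ x ∈ B (n - 1) (blk (n - 1) b), |qJetAt (ctrHalf n) n ν b (blk (n - 1) b) x| := Finset.sum_nonneg fun _ _ => abs_nonneg _
    have h := abs_fullSum_weight_le_of_blockDecay_mass n (f := fun w : Pt =>
        biBubbleTable (Ggh n a) (Ggh n a) (qAntiAt (ctrHalf n) n) (qAntiAt (ctrHalf n) n) μ ν (b + w) b)
      (F := fun u : Site 4 => ∑ z ∈ B (n - 1) (blk (n - 1) u), |qJetAt (ctrHalf n) n μ u (blk (n - 1) u) z|)
      (mul_nonneg hA0 hG') hδ (fun u => Finset.sum_nonneg fun _ _ => abs_nonneg _) (sum_B_jetMass_le n (ctrHalf_mem n) μ) b μ ν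
      (fun w => by
        have h1 := abs_T₆_le n a ha (ctrHalf n) μ ν (b + w) b
        calc _ ≤ _ := h1
          _ = A₆ * (∑ x ∈ B (n - 1) (blk (n - 1) b), |qJetAt (ctrHalf n) n ν b (blk (n - 1) b) x|) *
                Real.exp (-(deltaU 4 a * dist (blk (n - 1) (b + w)) (blk (n - 1) b))) *
                ∑ z ∈ B (n - 1) (blk (n - 1) (b + w)), |qJetAt (ctrHalf n) n μ (b + w) (blk (n - 1) (b + w)) z| := by rw [hA₆]; ring)
    refine h.trans (le_of_eq ?_)
    rw [hKK]
  -- the base sites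
  have hsum : |∑ b ∈ (univ : Finset (Fin 4 → Fin n)).image resSite, ((n : ℝ) ^ 4)⁻¹ * (((n : ℝ) ^ 8)⁻¹ *
        fullSum (fun w : Pt => toReal w μ * toReal w ν *
          biBubbleTable (Ggh n a) (Ggh n a) (qAntiAt (ctrHalf n) n) (qAntiAt (ctrHalf n) n) μ ν (b + w) b))|
      ≤ ((n : ℝ) ^ 8)⁻¹ * (A₆ * ((n : ℝ) ^ 2 * KK)) * (((n : ℝ) - 1) * ((n : ℝ) ^ 4)⁻¹) := by
    refine (Finset.abs_sum_le_sum_abs _ _).trans ?_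
    calc ∑ b ∈ (univ : Finset (Fin 4 → Fin n)).image resSite, |((n : ℝ) ^ 4)⁻¹ * (((n : ℝ) ^ 8)⁻¹ *
          fullSum (fun w : Pt => toReal w μ * toReal w ν *
            biBubbleTable (Ggh n a) (Ggh n a) (qAntiAt (ctrHalf n) n) (qAntiAt (ctrHalf n) n) μ ν (b + w) b))|
        ≤ ∑ b ∈ (univ : Finset (Fin 4 → Fin n)).image resSite, ((n : ℝ) ^ 8)⁻¹ * (A₆ * ((n : ℝ) ^ 2 * KK)) *
            (((n : ℝ) ^ 4)⁻¹ * ∑ x ∈ B (n - 1) (blk (n - 1) b), |qJetAt (ctrHalf n) n ν b (blk (n - 1) b) x|) := by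
          refine Finset.sum_le_sum fun b _ => ?_
          rw [abs_mul, abs_mul, abs_of_nonneg (by positivity : (0 : ℝ) ≤ ((n : ℝ) ^ 4)⁻¹),
            abs_of_nonneg (by positivity : (0 : ℝ) ≤ ((n : ℝ) ^ 8)⁻¹)]
          calc ((n : ℝ) ^ 4)⁻¹ * (((n : ℝ) ^ 8)⁻¹ * |fullSum (fun w : Pt => toReal w μ * toReal w ν *
                biBubbleTable (Ggh n a) (Ggh n a) (qAntiAt (ctrHalf n) n) (qAntiAt (ctrHalf n) n) μ ν (b + w) b)|)
              ≤ ((n : ℝ) ^ 4)⁻¹ * (((n : ℝ) ^ 8)⁻¹ * ((A₆ * ∑ x ∈ B (n - 1) (blk (n - 1) b), |qJetAt (ctrHalf n) n ν b (blk (n - 1) b) x|) *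
                  ((n : ℝ) ^ 2 * KK))) := by gcongr; exact hword b
            _ = _ := by ring
      _ = ((n : ℝ) ^ 8)⁻¹ * (A₆ * ((n : ℝ) ^ 2 * KK)) * ∑ b ∈ (univ : Finset (Fin 4 → Fin n)).image resSite,
            ((n : ℝ) ^ 4)⁻¹ * ∑ x ∈ B (n - 1) (blk (n - 1) b), |qJetAt (ctrHalf n) n ν b (blk (n - 1) b) x| := by rw [Finset.mul_sum]
      _ ≤ ((n : ℝ) ^ 8)⁻¹ * (A₆ * ((n : ℝ) ^ 2 * KK)) * (((n : ℝ) - 1) * ((n : ℝ) ^ 4)⁻¹) :=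
          mul_le_mul_of_nonneg_left (sum_resSite_jetMass_le n ν) (by positivity)
  rw [abs_mul]
  refine (mul_le_mul_of_nonneg_left hsum (abs_nonneg c)).trans ?_
  refine mul_le_mul_of_nonneg_left ?_ (abs_nonneg c)
  -- the n-power ledger: n⁻⁸ · (cG² + n⁴cG S) · n² · n⁴·(n−1)·n⁻⁴ · (n−1)·n⁻⁴ ≤ n⁻⁴ · (cG² + cG S) · (…)
  have hA₆le : A₆ ≤ (n : ℝ) ^ 4 * ((cG 4 a) ^ 2 + cG 4 a * (2 / min 2 a)) := by
    rw [hA₆]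
    have h4 : (1 : ℝ) ≤ (n : ℝ) ^ 4 := one_le_pow₀ hn1
    nlinarith [mul_nonneg hcG hcG, mul_nonneg hcG hS]
  have hKKle : KK ≤ (1 + 4 / deltaU 4 a) ^ 2 * ((n : ℝ) * latticeConst 4 (deltaU 4 a / 2)) := by
    rw [hKK]
    have h1 : (n : ℝ) ^ 4 * (((n : ℝ) - 1) * ((n : ℝ) ^ 4)⁻¹) ≤ n := by
      rw [show (n : ℝ) ^ 4 * (((n : ℝ) - 1) * ((n : ℝ) ^ 4)⁻¹) = (n : ℝ) - 1 by field_simp]; linarith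
    exact mul_le_mul_of_nonneg_left (mul_le_mul_of_nonneg_right h1 hL) (by positivity)
  have hn1' : ((n : ℝ) - 1) * ((n : ℝ) ^ 4)⁻¹ ≤ (n : ℝ) * ((n : ℝ) ^ 4)⁻¹ :=
    mul_le_mul_of_nonneg_right (by linarith) (by positivity)
  calc ((n : ℝ) ^ 8)⁻¹ * (A₆ * ((n : ℝ) ^ 2 * KK)) * (((n : ℝ) - 1) * ((n : ℝ) ^ 4)⁻¹)
      ≤ ((n : ℝ) ^ 8)⁻¹ * (((n : ℝ) ^ 4 * ((cG 4 a) ^ 2 + cG 4 a * (2 / min 2 a))) *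
          ((n : ℝ) ^ 2 * ((1 + 4 / deltaU 4 a) ^ 2 * ((n : ℝ) * latticeConst 4 (deltaU 4 a / 2))))) * ((n : ℝ) * ((n : ℝ) ^ 4)⁻¹) := by
        gcongr
    _ = ((n : ℝ) ^ 4)⁻¹ * (((cG 4 a) ^ 2 + cG 4 a * (2 / min 2 a)) * ((1 + 4 / deltaU 4 a) ^ 2 * latticeConst 4 (deltaU 4 a / 2))) := by
        field_simp

/-! ## §3 In the glue's currency: `h₆` from ONE units line (tolerance `n⁴`) -/

section Glue

variable {a : ℝ} {ωgh cQ : ℕ → ℝ} {k : ℝ}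

/-- [folklore] **«NT-6 ROW»: THE GHOST BUBBLE ROW `h₆` (`qA ⊗ qA` over `Ggh`) OF THE NEEDLE GROUP MODULO THE UNITS LINE** — `(ha : 0 < a)
(hk : ∀ n ≥ 2, |ωgh n·(cQ n·cQ n)| ≤ k·n⁴)` ⊢ `h₆` of `NeedleRowGlue.abs_gN_row_le_of_tables` VERBATIM, with the explicit n-FREE constant
`C₆ := k·(((cG 4 a)² + cG 4 a·(2∕min 2 a))·((1 + 4∕deltaU 4 a)²·latticeConst 4 (deltaU 4 a∕2)))` — TOLERANCE `n⁴` (owner U-1; at the ray of record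
`|ωgh·cQ²| = 4N²a²·n⁴`, so `k := 4N²a²` — ruled nowhere in this file). -/
theorem h₆_of_scaling (ha : 0 < a) (hk : ∀ n : ℕ, 2 ≤ n → |ωgh n * (cQ n * cQ n)| ≤ k * (n : ℝ) ^ 4) (μ ν : Fin 4) :
    ∀ n : ℕ, 2 ≤ n → ∀ [NeZero n], |ωgh n * (cQ n * cQ n) * ∑ b ∈ (univ : Finset (Fin 4 → Fin n)).image resSite, ((n : ℝ) ^ 4)⁻¹ *
      (((n : ℝ) ^ 8)⁻¹ * fullSum (fun w : Pt => toReal w μ * toReal w ν *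
        biBubbleTable (Ggh n a) (Ggh n a) (qAntiAt (ctrHalf n) n) (qAntiAt (ctrHalf n) n) μ ν (b + w) b))|
        ≤ k * (((cG 4 a) ^ 2 + cG 4 a * (2 / min 2 a)) * ((1 + 4 / deltaU 4 a) ^ 2 * latticeConst 4 (deltaU 4 a / 2))) := by
  intro n hn _
  have hn0 : (0 : ℝ) < n := by exact_mod_cast (show 0 < n by omega)
  have h1 := abs_row₆_le n a ha (ωgh n * (cQ n * cQ n)) μ ν
  have hK : 0 ≤ ((cG 4 a) ^ 2 + cG 4 a * (2 / min 2 a)) * ((1 + 4 / deltaU 4 a) ^ 2 * latticeConst 4 (deltaU 4 a / 2)) := by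
    have := (cG_pos 4 ha).le; have := const_nonneg a ha; have := latticeConst_nonneg 4 (half_pos (deltaU_pos 4 ha)).le; positivity
  refine h1.trans ?_
  have h2 : |ωgh n * (cQ n * cQ n)| * ((n : ℝ) ^ 4)⁻¹ ≤ k := by
    rw [← le_div_iff₀ (inv_pos.2 (pow_pos hn0 4)), div_inv_eq_mul]
    exact hk n hn
  calc |ωgh n * (cQ n * cQ n)| * (((n : ℝ) ^ 4)⁻¹ * (((cG 4 a) ^ 2 + cG 4 a * (2 / min 2 a)) *
        ((1 + 4 / deltaU 4 a) ^ 2 * latticeConst 4 (deltaU 4 a / 2))))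
      = (|ωgh n * (cQ n * cQ n)| * ((n : ℝ) ^ 4)⁻¹) * (((cG 4 a) ^ 2 + cG 4 a * (2 / min 2 a)) *
        ((1 + 4 / deltaU 4 a) ^ 2 * latticeConst 4 (deltaU 4 a / 2))) := by ring
    _ ≤ _ := mul_le_mul_of_nonneg_right h2 hK

end Glue

end Summit.QuantumFields.BalabanUV.Beta.D1BFx.NeedleGhostBubble2Row

end
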